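import Summits.QuantumFields.YangMills.Theorems.BalabanUVNodesN07RecordLettersReality
import Summits.QuantumFields.YangMills.Theorems.BalabanUVNodesN07ConstraintLetterTangent
import HarnessLib

/-!
# NODE N07 — THE REAL SLICE OF def-Y's CONSTRAINT LETTER: along a HERMITIAN direction `A′` (print's variables (19)∕(51)) the values `C^{𝔰𝔩}(tA′)(c)` are
# HERMITIAN for real `t` near `0` at every guarded `SU(N)` background ([15] (44) p. 285, (20) p. 281: `(1/i)·log` of a unitary near `1` is Hermitian;
# [B7] (22)–(23) p. 21) — the input of the reality of `C⁽²⁾ = quadPart C^{𝔰𝔩}` (letter `hC2` of ✓`…N07Delta2OfRecordReal`)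

Cell `pub-ymgap`, width seat `pub-ymgap-dag-n07-w3` (g26), CLAIM-5.  `--kind proof --supports stmt-QuantumFields-27238 --as helper`; count-neutral.
[15] = [Balaban1985Variational]; [B7] = [Balaban1985Averaging]; [B9] = [Balaban1985BackgroundPropagators].

THE COMPUTATION.  `C(A′)(c) = (1/i)·log(Ū^k_h(exp(iη_kA′)U₀)(c)·(Ū^kU₀)(c)⋆) − (Q_k(U₀)A′)(c)` (def-Y 3e′ `COfRecord_apply`), `C^{𝔰𝔩} = C ∘ P` (3f′).  For `A′` with Hermitian
presented field and real `t`, `η_k·P(tA′)` is Hermitian traceless, so `exp(itη_kPA′)·U₀` is g25's `SU(N)` chart `expChart U₀ (t • Ad_{U₀⁻¹}(iη_kPA′))`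
(✓`coeField_expChart_adInv_eq_expOver`), on which the holomorphic average IS the genuine one for `t` near `0` (n07-w2 ✓`eventually_smallBelow_expChart`, def-Y
✓`iterMh_coeField_of_smallBelow`); the argument of `log` is then a product of two `SU(N)` matrices tending to `1`, so for `t` near `0` it is a unitary within `1/4`
of `1` and `(log u)⋆ = −log u` (lit ✓`B7Prop2Explicit.star_mlog_eq_neg`), i.e. `(1/i)·log u` is Hermitian; the linear term is Hermitian by the reality of print's
`Q_k(U₀)` (✓`N07RecordLettersReality.qCplxOp_star`).
* §1 `star_slProj` (`π(Xᴴ) = (πX)ᴴ`), `star_evLit_slProjLit` , `star_inv_I_smul_of_star_eq_neg` (`((1/i)·X)ᴴ = (1/i)·X` for skew `X`), `mem_unitary_coe_mul_star_coe`.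
* §2 ★★★ `star_CslOfRecord_line_eventually` — `∀ᶠ t near 0, ∀ c, (C^{𝔰𝔩}(tA′)(c))ᴴ = C^{𝔰𝔩}(tA′)(c)`; `CslOfRecord_line_conj_eventually` (the same as
  `σ(C^{𝔰𝔩}(tA′)) = C^{𝔰𝔩}(tA′)` for the bondwise conjugation `σ` of block fields).

HONEST LABELS.  Bookkeeping over the tree's own chart ∕ averaging ∕ logarithm (no estimate of the series); the guard `SmallBelow (avOfRecord F N K) k U₀` displayed.
Count-neutral; N07 NOT discharged; P0 ⟨26900⟩ OPEN; R4 is the conditional finite-𝕋⁴ rung only.  Nothing here is a claim about the Yang–Mills mass gap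
(`Summit.QuantumFields`): finite torus, fixed `ε`; nothing continuum ∕ OS ∕ Clay.
-/

set_option autoImplicit false

noncomputable section

open scoped Matrix Matrix.Norms.L2Operator InnerProductSpace ComplexConjugate Topology

namespace Summit.QuantumFields.YangMills.Theorems.N07COfRecordRealSlice

open Filter
open Literature.MathematicalPhysics.QuantumFieldTheory.Balaban1983to89
open Literature.MathematicalPhysics.QuantumFieldTheory.Balaban1983to89.T4Continuum (T4Family)
open T4Continuum BlockAveraging
open NormedSpace (exp)
open ExpMeanLog (expMeanLogSU)
open MatrixLog (mlog)
open B15AveragingHolomorphic (iterMh)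
open B11Eq115Space (NegSize NegSup levWeight JetSup)
open B12Lemma4Models (slProj slProj_apply trace_slProj)
open T4AdjointCovarianceUnitary (lieSU mem_lieSU_iff specialUnitaryAd)
open Node00
open Summit.QuantumFields.YangMills.Theorems.N07ConstraintLetterTangent (I_smul_mem_lieSU coeField_expChart_adInv_eq_expOver)
open Summit.QuantumFields.YangMills.Theorems.N07RecordLettersReality (qCplxOp_star)

/-! ## §1  Fibre bookkeeping -/

section Fibre

variable {N : ℕ}

/-- `π(Xᴴ) = (πX)ᴴ` for the traceless projection `π X = X − (tr X ∕ N)·1`. [cite: Balaban1987RG1, (1.8) p.261; Balaban1985Variational, (51) p.286] -/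
theorem star_slProj (X : Matrix (Fin N) (Fin N) ℂ) : star (slProj N X) = slProj N (star X) := by
  rw [slProj_apply, slProj_apply, star_sub, star_smul, star_one, Matrix.star_eq_conjTranspose, Matrix.trace_conjTranspose, star_mul']
  congr 2
  simp

/-- `((1/i)·X)ᴴ = (1/i)·X` for skew-Hermitian `X`. [folklore] [cite: Balaban1985Variational, (20) p.281] -/
theorem star_inv_I_smul_of_star_eq_neg {X : Matrix (Fin N) (Fin N) ℂ} (hX : star X = -X) : star ((Complex.I⁻¹ : ℂ) • X) = (Complex.I⁻¹ : ℂ) • X := by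
  rw [star_smul, hX, Complex.star_def, map_inv₀, Complex.conj_I, inv_neg, neg_smul, smul_neg, neg_neg]

/-- `W·V⋆` is a unitary for `W, V ∈ SU(N)`. [folklore] [cite: Balaban1985Variational, (4) p.278] -/
theorem mem_unitary_coe_mul_star_coe (W V : SU N) : (W : Matrix (Fin N) (Fin N) ℂ) * star (V : Matrix (Fin N) (Fin N) ℂ) ∈ unitary (Matrix (Fin N) (Fin N) ℂ) := by
  have h := (Matrix.mem_specialUnitaryGroup_iff.mp (W * V⁻¹).2).1
  rwa [Submonoid.coe_mul, coe_inv_SU] at h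

end Fibre

/-! ## §2  The real slice of `C^{𝔰𝔩}` along Hermitian lines -/

section Record

variable (F : T4Family) (N : ℕ) [NeZero N] (K : ℕ) (k : ℕ) (Ω : ℕ → Set (Site (F.P K) 0)) (U₀ : GaugeField (F.P K) 0 (SU N))
  [Fact (0 < (F.L : ℝ))] [Fact (0 < (F.P K).eta k)] (levB : PBond (F.P K) k → ℕ)

omit [NeZero N] in
/-- The presented field of `P A′` is Hermitian when that of `A′` is. [cite: Balaban1985Variational, (19) p.281, (51) p.286] -/
theorem star_evLit_slProjLit {A : Space115Lit F N K k Ω U₀} (hA : ∀ b, star (evLit F N K k Ω U₀ A b) = evLit F N K k Ω U₀ A b) (b : PBond (F.P K) 0) :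
    star (evLit F N K k Ω U₀ (slProjLit F N K k Ω U₀ A) b) = evLit F N K k Ω U₀ (slProjLit F N K k Ω U₀ A) b := by
  rw [evLit_slProjLit, star_slProj, hA]

/-- ★★★ **THE REAL SLICE**: at a guarded background, along a direction `A′` whose presented field is Hermitian, the values `C^{𝔰𝔩}(tA′)(c)` are HERMITIAN for real
`t` near `0` — `(1/i)·log` of a unitary near `1` plus a Hermitian linear term. [cite: Balaban1985Variational, (44) p.285, (20) p.281, (19) p.281; Balaban1985Averaging, (22)–(23) p.21; Balaban1985BackgroundPropagators, (3.13) p.393] -/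
theorem star_CslOfRecord_line_eventually (hU₀ : SmallBelow (avOfRecord F N K) k U₀) {A : Space115Lit F N K k Ω U₀}
    (hA : ∀ b, star (evLit F N K k Ω U₀ A b) = evLit F N K k Ω U₀ A b) :
    ∀ᶠ t : ℝ in 𝓝 0, ∀ c : PBond (F.P K) k,
      star (NegSup.equiv _ _ (CslOfRecord F N K k Ω U₀ levB ((t : ℂ) • A)) c) = NegSup.equiv _ _ (CslOfRecord F N K k Ω U₀ levB ((t : ℂ) • A)) c := by
  letI : CStarAlgebra (Matrix (Fin N) (Fin N) ℂ) := {}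
  -- the Hermitian traceless direction `Y = η_k·P A′` and its 𝔰𝔲(N) chart
  set Y : PBond (F.P K) 0 → Matrix (Fin N) (Fin N) ℂ := ((((F.P K).eta k : ℝ) : ℂ)) • evLit F N K k Ω U₀ (slProjLit F N K k Ω U₀ A) with hYdef
  have hY : ∀ b, star (Y b) = Y b := fun b => by
    rw [hYdef, Pi.smul_apply, star_smul, Complex.star_def, Complex.conj_ofReal, star_evLit_slProjLit F N K k Ω U₀ hA]
  have htr : ∀ b, (Y b).trace = 0 := fun b => by
    rw [hYdef, Pi.smul_apply, Matrix.trace_smul, evLit_slProjLit, trace_slProj, smul_zero]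
  set W : PBond (F.P K) 0 → lieSU (Fin N) := fun b => specialUnitaryAd (U₀ b)⁻¹ ⟨Complex.I • Y b, I_smul_mem_lieSU (hY b) (htr b)⟩ with hW
  -- (e1) the guard holds along the chart near `t = 0`
  have ht : Tendsto (fun t : ℝ => t • W) (𝓝 0) (𝓝 0) := by
    have hc : Continuous fun t : ℝ => t • W := continuous_id.smul continuous_const
    simpa only [zero_smul] using hc.tendsto 0
  have hev₁ : ∀ᶠ t : ℝ in 𝓝 0, SmallBelow (avOfRecord F N K) k (expChart U₀ (t • W)) := ht.eventually (eventually_smallBelow_expChart hU₀)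
  -- (e2) the argument of `log` is within `1/4` of `1` near `t = 0`, at every coarse bond
  have hev₂ : ∀ᶠ t : ℝ in 𝓝 0, ∀ c : PBond (F.P K) k,
      ‖((Averaging.iter (avOfRecord F N K) k (expChart U₀ (t • W)) c : SU N) : Matrix (Fin N) (Fin N) ℂ) *
          star ((Averaging.iter (avOfRecord F N K) k U₀ c : SU N) : Matrix (Fin N) (Fin N) ℂ) - 1‖ < 1 / 4 := by
    refine eventually_all.2 fun c => ?_
    have hcont : ContinuousAt (fun t : ℝ => ((Averaging.iter (avOfRecord F N K) k (expChart U₀ (t • W)) c : SU N) : Matrix (Fin N) (Fin N) ℂ) *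
        star ((Averaging.iter (avOfRecord F N K) k U₀ c : SU N) : Matrix (Fin N) (Fin N) ℂ) - 1) 0 :=
      ((hasDerivAt_coe_iter_expChart_smul hU₀ W c).continuousAt.mul continuousAt_const).sub continuousAt_const
    have h0 : ((Averaging.iter (avOfRecord F N K) k (expChart U₀ ((0 : ℝ) • W)) c : SU N) : Matrix (Fin N) (Fin N) ℂ) *
        star ((Averaging.iter (avOfRecord F N K) k U₀ c : SU N) : Matrix (Fin N) (Fin N) ℂ) - 1 = 0 := by
      rw [zero_smul, expChart_zero, coe_mul_star_coe_SU, sub_self]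
    have htn : Tendsto (fun t : ℝ => ‖((Averaging.iter (avOfRecord F N K) k (expChart U₀ (t • W)) c : SU N) : Matrix (Fin N) (Fin N) ℂ) *
        star ((Averaging.iter (avOfRecord F N K) k U₀ c : SU N) : Matrix (Fin N) (Fin N) ℂ) - 1‖) (𝓝 0) (𝓝 0) := by
      have h := hcont.norm.tendsto
      rwa [h0, norm_zero] at h
    exact htn.eventually (Iio_mem_nhds (by norm_num : (0 : ℝ) < 1 / 4))
  filter_upwards [hev₁, hev₂] with t h₁ h₂ c
  -- the chart field of `C` at `t·P A′` is the `SU(N)` curve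
  have hchart : expOver U₀ ((((F.P K).eta k : ℝ) : ℂ) • evLit F N K k Ω U₀ (slProjLit F N K k Ω U₀ ((t : ℂ) • A))) = coeField (expChart U₀ (t • W)) := by
    rw [coeField_expChart_adInv_eq_expOver U₀ hY htr t, map_smul, map_smul, smul_comm, hYdef]
  set G : Matrix (Fin N) (Fin N) ℂ := ((Averaging.iter (avOfRecord F N K) k (expChart U₀ (t • W)) c : SU N) : Matrix (Fin N) (Fin N) ℂ) with hG
  set V : Matrix (Fin N) (Fin N) ℂ := ((Averaging.iter (avOfRecord F N K) k U₀ c : SU N) : Matrix (Fin N) (Fin N) ℂ) with hV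
  have hlog : star (mlog (G * star V)) = -mlog (G * star V) :=
    B7Prop2Explicit.star_mlog_eq_neg (mem_unitary_coe_mul_star_coe _ _) (h₂ c).le
  have hlin : star (qCplxOp k U₀ (evLit F N K k Ω U₀ (slProjLit F N K k Ω U₀ ((t : ℂ) • A))) c) =
      qCplxOp k U₀ (evLit F N K k Ω U₀ (slProjLit F N K k Ω U₀ ((t : ℂ) • A))) c := by
    have hs : star (evLit F N K k Ω U₀ (slProjLit F N K k Ω U₀ A)) = evLit F N K k Ω U₀ (slProjLit F N K k Ω U₀ A) :=
      funext fun b => star_evLit_slProjLit F N K k Ω U₀ hA b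
    rw [map_smul, map_smul, map_smul, Pi.smul_apply, star_smul, Complex.star_def, Complex.conj_ofReal, ← qCplxOp_star hU₀, hs]
  rw [CslOfRecord_apply, COfRecord_apply, hchart, iterMh_coeField_of_smallBelow F N k _ h₁, coeField_apply, ← hG, ← hV, star_sub,
    star_inv_I_smul_of_star_eq_neg hlog, hlin]

/-- ★★★ **THE REAL SLICE, conjugation form**: for `t` near `0` the block field `C^{𝔰𝔩}(tA′)` is FIXED by the bondwise conjugation `Z ↦ (c ↦ Z(c)ᴴ)`.
[cite: Balaban1985Variational, (44) p.285, (20) p.281] -/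
theorem CslOfRecord_line_conj_eventually (hU₀ : SmallBelow (avOfRecord F N K) k U₀) {A : Space115Lit F N K k Ω U₀}
    (hA : ∀ b, star (evLit F N K k Ω U₀ A b) = evLit F N K k Ω U₀ A b) :
    ∀ᶠ t : ℝ in 𝓝 0, (NegSup.equiv _ _).symm (star (NegSup.equiv _ _ (CslOfRecord F N K k Ω U₀ levB ((t : ℂ) • A)))) =
      CslOfRecord F N K k Ω U₀ levB ((t : ℂ) • A) := by
  filter_upwards [star_CslOfRecord_line_eventually F N K k Ω U₀ levB hU₀ hA] with t ht
  apply (NegSup.equiv _ _).injective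
  rw [Equiv.apply_symm_apply]
  funext c
  rw [Pi.star_apply, ht c]

end Record

end Summit.QuantumFields.YangMills.Theorems.N07COfRecordRealSlice

end
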